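import Mathlib.NumberTheory.NumberField.Basic
import Summits.Langlands.Langlands.Theorems.PhantomRMYoshidaFaltingsFinitenessIOfIsogenyBound
import Summits.Langlands.Langlands.Theorems.PhantomRMYoshidaFaltingsFinitenessIKernelBoundConverse
import Literature.NumberTheory.DiophantineGeometry.MasserWustholzIsogenyTheorem
import Literature.AlgebraicGeometry.Motives.FaltingsFinitenessI
import HarnessLib

/-!
# Route PhantomRMYoshida — FaltingsFinitenessI (item stmt-Langlands-15084): Finiteness I from the Masser–Wüstholz isogeny theorem

Line `Sketch` of the crux (card `isogeny-degree-bound`): the one transcendental input of the line,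
the **Masser–Wüstholz isogeny theorem** (Publ. Math. IHÉS 81 (1995), Theorem II, polarisation-free),
is the Literature named fact `Literature.NumberTheory.DiophantineGeometry.exists_isogeny_kerRank_le_of_isIsogenous A`
(qualitative form: for `A` over a number field there is `N` with an isogeny `A → B` of degree
`≤ N` onto every `B` admitting an isogeny `B → A`). Through the sorry-free counting reduction
`exists_isoClasses_of_isogeny_kerRank_le` of the sibling file `…FaltingsFinitenessIOfIsogenyBound`
(bound the degree, then count geometric kernels inside `A[N!](K̄)`) it yields:

* `stub_faltingsFinitenessI_of_masserWustholz` / `faltingsFinitenessI_of_masserWustholz` — the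
  route decl `FaltingsFinitenessI` (item stmt-Langlands-15084, Finiteness I over `ℚ`) from the fact
  at the abelian varieties over `ℚ`: the line's skeleton CLOSED MODULO that named fact (the item
  stays open and conditional until the fact is discharged — period theorem, stable Faltings height
  in dimension `≥ 2`, Zarhin's trick are absent from Mathlib and the tree);
* `finite_isoClasses_isogenous_of_exists_isogeny_kerRank_le` — the Literature named fact
  `AbelianVariety.finite_isoClasses_isogenous A` (Faltings' Finiteness I over any number field,
  Milne *Abelian Varieties* (2008) IV Thm. 1.1) at `A` from the Masser–Wüstholz fact at `A`: the
  transcendence road to Faltings' finiteness theorem (Baker–Wüstholz 2007, §7.4, p. 165: the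
  isogeny theorem "enables one to show that an isogeny class contains only finitely many
  isomorphism classes"), kernel-checked down to that one named input;
* `exists_isogeny_kerRank_le_of_isoClasses` (any field of characteristic `0`) and
  `finite_isoClasses_isogenous_iff_exists_isogeny_kerRank_le` — conversely finitely many
  isomorphism classes give the bound (one isogeny per representative, `IsIsogenous.symm_of_charZero`,
  transported along `B ≅ C i` by `kerRank_comp_inv_of_iso` of the sibling file
  `…FaltingsFinitenessIKernelBoundConverse`), so **the two Literature named facts
  `finite_isoClasses_isogenous A` (Faltings) and `exists_isogeny_kerRank_le_of_isIsogenous A`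
  (Masser–Wüstholz, qualitative) are equivalent at every `A` over a number field** — the new fact
  adds no strength to the tree's trust base, only the statement the effective method proves.

Pure-proof file (the fact lives under `Literature/`).
-/

set_option linter.dupNamespace false -- as in the sibling Theorems files: `Summit.Langlands.Langlands` is the mandated namespace (summit = sub-problem)

noncomputable section

open CategoryTheory
open Literature.AlgebraicGeometry.Motives
open Literature.AlgebraicGeometry.Motives.AbelianVariety
open Literature.NumberTheory.DiophantineGeometry

universe u

namespace Summit.Langlands.Langlands.Theorems.PhantomRMYoshida

/-- **Finiteness I over `ℚ` from the Masser–Wüstholz isogeny theorem** — the registered stub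
`stub_faltingsFinitenessI_of_masserWustholz` of line `Sketch` (the skeleton closed modulo the named
fact): the route decl `FaltingsFinitenessI` (item stmt-Langlands-15084) follows from
`exists_isogeny_kerRank_le_of_isIsogenous A` (Masser–Wüstholz 1995, Theorem II, qualitative form)
for the abelian varieties `A` over `ℚ`, through `faltingsFinitenessI_of_isogenyKernelBound`.
[cite: MasserWustholz1995, Theorem II (p. 6)] -/
theorem stub_faltingsFinitenessI_of_masserWustholz
    (h : ∀ A : AbelianVariety ℚ, Literature.NumberTheory.DiophantineGeometry.exists_isogeny_kerRank_le_of_isIsogenous A) :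
    Summit.Langlands.Langlands.Theses.PhantomRMYoshida.FaltingsFinitenessI :=
  faltingsFinitenessI_of_isogenyKernelBound fun A => h A

/-- **Finiteness I over `ℚ` from the Masser–Wüstholz isogeny theorem** (descriptive name of the
stub `stub_faltingsFinitenessI_of_masserWustholz`; conditional closer of item stmt-Langlands-15084).
[cite: MasserWustholz1995, Theorem II (p. 6)] -/
theorem faltingsFinitenessI_of_masserWustholz
    (h : ∀ A : AbelianVariety ℚ, exists_isogeny_kerRank_le_of_isIsogenous A) :
    Summit.Langlands.Langlands.Theses.PhantomRMYoshida.FaltingsFinitenessI :=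
  stub_faltingsFinitenessI_of_masserWustholz h

/-- **Faltings' Finiteness I at `A` from the Masser–Wüstholz isogeny theorem at `A`**, over any
number field: the Literature named fact `AbelianVariety.finite_isoClasses_isogenous A` (Milne,
*Abelian Varieties* (2008), IV Thm. 1.1; Faltings 1983, §6) follows from
`exists_isogeny_kerRank_le_of_isIsogenous A` by the counting reduction
`exists_isoClasses_of_isogeny_kerRank_le` (valid over every field of characteristic `0`) — the
transcendence proof of Finiteness I (Masser–Wüstholz 1993/1995; Baker–Wüstholz 2007, §7.4,
p. 165), machine-checked down to the isogeny theorem. [cite: MasserWustholz1995, Theorem II (p. 6)] -/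
theorem finite_isoClasses_isogenous_of_exists_isogeny_kerRank_le {K : Type u} [Field K]
    (A : AbelianVariety K) (h : exists_isogeny_kerRank_le_of_isIsogenous A) :
    finite_isoClasses_isogenous A := by
  intro
  obtain ⟨N, hN⟩ := h
  exact exists_isoClasses_of_isogeny_kerRank_le A hN

/-- **Finitely many isomorphism classes give an isogeny-degree bound** (any field of
characteristic `0`; the converse of `exists_isoClasses_of_isogeny_kerRank_le`): if a finite family
`C : Fin n → AbelianVariety K` contains, up to isomorphism, every `B` admitting an isogeny `B → A`,
then there is `N` such that every such `B` is the target of an isogeny `A → B` of degree `≤ N` —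
for each `i` with `C i` isogenous to `A` choose an isogeny `gᵢ : A → C i` (symmetry of isogeny in
characteristic `0`, `IsIsogenous.symm_of_charZero`, Mumford §19, Remark p. 169), put
`N = sup_i deg gᵢ` and transport along `e : B ≅ C i` (`kerRank_comp_inv_of_iso`). Same proof as
`isogenyKernelBound_of_faltingsFinitenessI` (the case `K = ℚ`). [folklore] -/
theorem exists_isogeny_kerRank_le_of_isoClasses {K : Type u} [Field K] [CharZero K]
    (A : AbelianVariety K) {n : ℕ} {C : Fin n → AbelianVariety K}
    (hC : ∀ B : AbelianVariety K, IsIsogenous B A → ∃ i, Nonempty (B ≅ C i)) :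
    ∃ N : ℕ, ∀ B : AbelianVariety K, IsIsogenous B A →
      ∃ g : A ⟶ B, IsIsogeny g ∧ Hom.kerRank g ≤ N := by
  -- for each representative `C i`, a homomorphism `A → C i` that is an isogeny if `C i ∼ A`
  have key : ∀ i : Fin n, ∃ g : A ⟶ C i, IsIsogenous (C i) A → IsIsogeny g := fun i => by
    by_cases h : IsIsogenous (C i) A
    · obtain ⟨g, hg⟩ := IsIsogenous.symm_of_charZero h
      exact ⟨g, fun _ => hg⟩
    · exact ⟨0, fun h' => absurd h' h⟩
  choose g hg using key
  refine ⟨Finset.univ.sup fun i => Hom.kerRank (g i), fun B hB => ?_⟩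
  obtain ⟨i, ⟨e⟩⟩ := hC B hB
  have hi : IsIsogenous (C i) A :=
    hB.elim fun f hf => ⟨e.inv ≫ f, isIsogeny_comp (isIsogeny_hom_of_iso e.symm) hf⟩
  refine ⟨g i ≫ e.inv, isIsogeny_comp (hg i hi) (isIsogeny_hom_of_iso e.symm), ?_⟩
  rw [kerRank_comp_inv_of_iso (hg i hi) e]
  exact Finset.le_sup (f := fun i => Hom.kerRank (g i)) (Finset.mem_univ i)

/-- **The two named facts are equivalent**: for an abelian variety `A` over a number field,
Faltings' Finiteness I at `A` (`AbelianVariety.finite_isoClasses_isogenous A`, Milne *Abelian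
Varieties* (2008) IV Thm. 1.1) holds iff the qualitative Masser–Wüstholz isogeny theorem at `A`
(`exists_isogeny_kerRank_le_of_isIsogenous A`, Publ. Math. IHÉS 81 (1995) Thm. II) does —
`exists_isoClasses_of_isogeny_kerRank_le` one way, `exists_isogeny_kerRank_le_of_isoClasses` the
other. [folklore] -/
theorem finite_isoClasses_isogenous_iff_exists_isogeny_kerRank_le {K : Type u} [Field K]
    [NumberField K] (A : AbelianVariety K) :
    finite_isoClasses_isogenous A ↔ exists_isogeny_kerRank_le_of_isIsogenous A := by
  refine ⟨fun h _ => ?_, fun h => finite_isoClasses_isogenous_of_exists_isogeny_kerRank_le A h⟩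
  obtain ⟨n, C, hC⟩ := h
  exact exists_isogeny_kerRank_le_of_isoClasses A hC

end Summit.Langlands.Langlands.Theorems.PhantomRMYoshida

end
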